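import Summits.ValiantsHypothesis.ValiantsHypothesis.Theorems.KPlusLogSqLawValuativeDoorSidonTwoSharp
import Summits.ValiantsHypothesis.ValiantsHypothesis.Theorems.KPlusLogSqLawValuativeDoorGenTwoGram
import Summits.ValiantsHypothesis.ValiantsHypothesis.Theorems.KPlusLogSqLawValuativeDoorGenTwoSharpCore

/-!
# LINE `valuative_door` (crux `WeakLifting`, stmt-ValiantsHypothesis-19561) — the GENERAL width-two Sidon row is attained at `4K − 7`:
# for every `K`, a general `2 × 2` Sidon pencil with `4K − 6` dominant exponents (any non-archimedean field with a non-unit)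

HONEST FRAMING.  Helper (cell `pub-symmetroid`, seat val-sym-lift-p1 g23, 2026-08-29; `--supports 19561 --as helper`).  Companion of
`…GenTwoUnitTwoLaw.valGenSidonTwo_unitTwo_unfolded` (`v 2 = 1 ⇒ npEdges ≤ 4K − 7` for general `2 × 2` Sidon pencils): over ANY field with a
non-archimedean `v` and any `π` with `0 < v π < 1`, the pencil `d_i = 2^i`, `M_i = [[π^{(32i+64)2^i}, π^{(32i+104)2^i}], [π^{(32i+29)2^i},
π^{(32i+43)2^i}]]` has at least `4K − 6` dominant exponents (`valGenSidonTwo_sharp_unfolded`): the four bands `2^k + 2^{k+f}`, `f = 0..3`,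
dominate at the slopes `32k + 98, 120, 140, 166`, the first two through `a_k e_{k+f}` (diagonal letters), the last two through `b_k c_{k+f}`
(off-diagonal letters) — TWO STAIRCASES in the Gauss-norm picture `‖det‖ = max(‖α‖‖ε‖, ‖β‖‖γ‖)`; every coefficient has a
unique `v`-largest term (one-letter inequalities `…GenTwoSharpCore`, assembled in §1; counting `card_ge_of_four_bands`).  So the general Sidon row is EXACTLY
`4K − 7` at every place with `v 2 = 1` (`K ≥ 3`) and `≥ 4K − 7` everywhere (all-field upper bound `5K − 11`, `…GenTwoSidon`);
`valGenSidonTwo_sharp_real`: the tree's 2-adic place of `ℝ`.  Calibration only; no bearing on vW / vB, `TropicalB`, `MatrixDescartes` (18050)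
or VP ≠ VNP.  [elementary; design by integer search, exact check `K ≤ 24` (seat folder `exp/genfamily*.py`)]
-/

set_option linter.dupNamespace false
set_option autoImplicit false

namespace Summit.ValiantsHypothesis.ValiantsHypothesis.Theorems.KPlusLogSqLaw.ValDoor

open Polynomial Finset Matrix
open scoped BigOperators Classical

variable {F : Type*} [Field F]

/-! ## §1 The assembled dominance inequalities `n + s·E' < e + s·E` of the four bands -/

/-- band `f = 0` (target `a_k e_k`, slope `32k + 98`) beats every other `a_p e_q`. [`g0A`, `g0E`] -/
theorem gen0_vs_ae (k p q : ℕ) (h : ¬ (p = k ∧ q = k)) :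
    (32 * k + 64) * 2 ^ k + (32 * k + 43) * 2 ^ k + (32 * k + 98) * (2 ^ p + 2 ^ q)
      < (32 * p + 64) * 2 ^ p + (32 * q + 43) * 2 ^ q + (32 * k + 98) * (2 ^ k + 2 ^ k) := by
  by_cases hp : p = k
  · linarith [g0A_le k p, g0E_lt k q (fun hq => h ⟨hp, by simpa using hq⟩)]
  · linarith [g0A_lt k p (fun h' => hp (by simpa using h')), g0E_le k q]

/-- band `f = 0` beats every `b_p c_q`. [`g0B`, `g0C`] -/
theorem gen0_vs_bc (k p q : ℕ) :
    (32 * k + 64) * 2 ^ k + (32 * k + 43) * 2 ^ k + (32 * k + 98) * (2 ^ p + 2 ^ q)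
      < (32 * p + 104) * 2 ^ p + (32 * q + 29) * 2 ^ q + (32 * k + 98) * (2 ^ k + 2 ^ k) := by
  linarith [g0B_le k p, g0C_le k q, Nat.two_pow_pos k]

/-- band `f = 1` (target `a_k e_{k+1}`, slope `32k + 120`) beats every other `a_p e_q`. [`g1A`, `g1E`] -/
theorem gen1_vs_ae (k p q : ℕ) (h : ¬ (p = k ∧ q = k + 1)) :
    (32 * k + 64) * 2 ^ k + (32 * (k + 1) + 43) * 2 ^ (k + 1) + (32 * k + 120) * (2 ^ p + 2 ^ q)
      < (32 * p + 64) * 2 ^ p + (32 * q + 43) * 2 ^ q + (32 * k + 120) * (2 ^ k + 2 ^ (k + 1)) := by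
  rw [pow_succ]
  by_cases hp : p = k
  · linarith [g1A_le k p, g1E_lt k q (fun hq => h ⟨hp, hq⟩)]
  · linarith [g1A_lt k p (fun h' => hp (by simpa using h')), g1E_le k q]

/-- band `f = 1` beats every `b_p c_q`. [`g1B`, `g1C`] -/
theorem gen1_vs_bc (k p q : ℕ) :
    (32 * k + 64) * 2 ^ k + (32 * (k + 1) + 43) * 2 ^ (k + 1) + (32 * k + 120) * (2 ^ p + 2 ^ q)
      < (32 * p + 104) * 2 ^ p + (32 * q + 29) * 2 ^ q + (32 * k + 120) * (2 ^ k + 2 ^ (k + 1)) := by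
  rw [pow_succ]
  linarith [g1B_le k p, g1C_le k q, Nat.two_pow_pos k]

/-- band `f = 2` (target `b_k c_{k+2}`, slope `32k + 140`) beats every `a_p e_q`. [`g2A`, `g2E`] -/
theorem gen2_vs_ae (k p q : ℕ) :
    (32 * k + 104) * 2 ^ k + (32 * (k + 2) + 29) * 2 ^ (k + 2) + (32 * k + 140) * (2 ^ p + 2 ^ q)
      < (32 * p + 64) * 2 ^ p + (32 * q + 43) * 2 ^ q + (32 * k + 140) * (2 ^ k + 2 ^ (k + 2)) := by
  have e4 : (2 : ℕ) ^ (k + 2) = 2 ^ k * 4 := by rw [pow_add]; norm_num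
  rw [e4]
  linarith [g2A_le k p, g2E_le k q, Nat.two_pow_pos k]

/-- band `f = 2` beats every other `b_p c_q`. [`g2B`, `g2C`] -/
theorem gen2_vs_bc (k p q : ℕ) (h : ¬ (p = k ∧ q = k + 2)) :
    (32 * k + 104) * 2 ^ k + (32 * (k + 2) + 29) * 2 ^ (k + 2) + (32 * k + 140) * (2 ^ p + 2 ^ q)
      < (32 * p + 104) * 2 ^ p + (32 * q + 29) * 2 ^ q + (32 * k + 140) * (2 ^ k + 2 ^ (k + 2)) := by
  have e4 : (2 : ℕ) ^ (k + 2) = 2 ^ k * 4 := by rw [pow_add]; norm_num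
  rw [e4]
  by_cases hp : p = k
  · linarith [g2B_le k p, g2C_lt k q (fun hq => h ⟨hp, hq⟩)]
  · linarith [g2B_lt k p (fun h' => hp (by simpa using h')), g2C_le k q]

/-- band `f = 3` (target `b_k c_{k+3}`, slope `32k + 166`) beats every `a_p e_q`. [`g3A`, `g3E`] -/
theorem gen3_vs_ae (k p q : ℕ) :
    (32 * k + 104) * 2 ^ k + (32 * (k + 3) + 29) * 2 ^ (k + 3) + (32 * k + 166) * (2 ^ p + 2 ^ q)
      < (32 * p + 64) * 2 ^ p + (32 * q + 43) * 2 ^ q + (32 * k + 166) * (2 ^ k + 2 ^ (k + 3)) := by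
  have e8 : (2 : ℕ) ^ (k + 3) = 2 ^ k * 8 := by rw [pow_add]; norm_num
  rw [e8]
  linarith [g3A_le k p, g3E_le k q, Nat.two_pow_pos k]

/-- band `f = 3` beats every other `b_p c_q`. [`g3B`, `g3C`] -/
theorem gen3_vs_bc (k p q : ℕ) (h : ¬ (p = k ∧ q = k + 3)) :
    (32 * k + 104) * 2 ^ k + (32 * (k + 3) + 29) * 2 ^ (k + 3) + (32 * k + 166) * (2 ^ p + 2 ^ q)
      < (32 * p + 104) * 2 ^ p + (32 * q + 29) * 2 ^ q + (32 * k + 166) * (2 ^ k + 2 ^ (k + 3)) := by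
  have e8 : (2 : ℕ) ^ (k + 3) = 2 ^ k * 8 := by rw [pow_add]; norm_num
  rw [e8]
  by_cases hp : p = k
  · linarith [g3B_le k p, g3C_lt k q (fun hq => h ⟨hp, hq⟩)]
  · linarith [g3B_lt k p (fun h' => hp (by simpa using h')), g3C_le k q]

/-! ## §2 Four-term valuation tools, dominance, counting -/

/-- `v (x + y − z − w) = v x` when the other three terms are strictly smaller (non-archimedean). [folklore] -/
theorem abv_four_eq_first (v : AbsoluteValue F ℝ) (hv : IsNonarchimedean v) {x y z w : F} (hy : v y < v x) (hz : v z < v x)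
    (hw : v w < v x) : v (x + y - z - w) = v x := by
  have h1 : v (x + y) = v x := abv_add_eq_left_of_lt v hv hy
  have h2 : v (x + y - z) = v x := by
    rw [sub_eq_add_neg, abv_add_eq_left_of_lt v hv (by rw [v.map_neg, h1]; exact hz), h1]
  rw [sub_eq_add_neg, abv_add_eq_left_of_lt v hv (by rw [v.map_neg, h2]; exact hw), h2]

/-- `v (x + y − z − w) = v z` when the other three terms are strictly smaller (non-archimedean). [folklore] -/
theorem abv_four_eq_third (v : AbsoluteValue F ℝ) (hv : IsNonarchimedean v) {x y z w : F} (hx : v x < v z) (hy : v y < v z)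
    (hw : v w < v z) : v (x + y - z - w) = v z := by
  have e : x + y - z - w = -z + (x + (y + -w)) := by ring
  have h1 : v (x + (y + -w)) < v z :=
    lt_of_le_of_lt (hv _ _) (max_lt hx (lt_of_le_of_lt (hv _ _) (max_lt hy (by rw [v.map_neg]; exact hw))))
  rw [e, abv_add_eq_left_of_lt v hv (by rw [v.map_neg]; exact h1), v.map_neg]

/-- **dominance from termwise inequalities, four terms** (general letters `a, b, c, e`): as `dominant_of_termwise`, with the term
sizes `w^{A p + E q}`, `w^{A q + E p}`, `w^{B p + C q}`, `w^{B q + C p}` bounding the coefficient at `d p + d q`. [elementary] -/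
theorem dominant_of_termwise4 (v : AbsoluteValue F ℝ) {w : ℝ} (hw0 : 0 < w) (hw1 : w < 1) (f : F[X]) {K : ℕ}
    (d A B C E : Fin K → ℕ) (Ex n s : ℕ)
    (hsupp : ∀ E' ∈ f.support, ∃ p q : Fin K, E' = d p + d q)
    (hbound : ∀ p q : Fin K, v (f.coeff (d p + d q)) ≤
      max (max (w ^ (A p + E q)) (w ^ (A q + E p))) (max (w ^ (B p + C q)) (w ^ (B q + C p))))
    (hval : v (f.coeff Ex) = w ^ n)
    (hineq : ∀ p q : Fin K, d p + d q ≠ Ex →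
      n + s * (d p + d q) < A p + E q + s * Ex ∧ n + s * (d p + d q) < A q + E p + s * Ex ∧
        n + s * (d p + d q) < B p + C q + s * Ex ∧ n + s * (d p + d q) < B q + C p + s * Ex) :
    Ex ∈ f.support ∧ ∃ r : ℝ, 0 < r ∧ ∀ E' ∈ f.support, E' ≠ Ex → v (f.coeff E') * r ^ E' < v (f.coeff Ex) * r ^ Ex := by
  refine ⟨Polynomial.mem_support_iff.2 fun h0 => ?_, w⁻¹ ^ s, pow_pos (inv_pos.2 hw0) s, fun E' hE' hne => ?_⟩
  · rw [h0, map_zero] at hval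
    exact absurd hval (ne_of_lt (pow_pos hw0 n))
  · obtain ⟨p, q, rfl⟩ := hsupp E' hE'
    obtain ⟨h1, h2, h3, h4⟩ := hineq p q hne
    rw [hval]
    have hr : 0 < (w⁻¹ ^ s) ^ (d p + d q) := pow_pos (pow_pos (inv_pos.2 hw0) s) _
    refine lt_of_le_of_lt (mul_le_mul_of_nonneg_right (hbound p q) hr.le) ?_
    rcases max_cases (max (w ^ (A p + E q)) (w ^ (A q + E p))) (max (w ^ (B p + C q)) (w ^ (B q + C p))) with ⟨hm, -⟩ | ⟨hm, -⟩
    · rw [hm]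
      rcases max_cases (w ^ (A p + E q)) (w ^ (A q + E p)) with ⟨hm', -⟩ | ⟨hm', -⟩
      · rw [hm']; exact pow_mul_lt_of_ineq hw0 hw1 h1
      · rw [hm']; exact pow_mul_lt_of_ineq hw0 hw1 h2
    · rw [hm]
      rcases max_cases (w ^ (B p + C q)) (w ^ (B q + C p)) with ⟨hm', -⟩ | ⟨hm', -⟩
      · rw [hm']; exact pow_mul_lt_of_ineq hw0 hw1 h3
      · rw [hm']; exact pow_mul_lt_of_ineq hw0 hw1 h4

/-- **four dyadic bands:** if `D` contains `2^k + 2^{k+f}` whenever `f ≤ 3` and `k + f < K`, then `4K − 6 ≤ #D` (the map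
`(f, k) ↦ 2^k + 2^{k+f}` is injective by the Sidon property of the powers of two). [counting] -/
theorem card_ge_of_four_bands (K : ℕ) (D : Finset ℕ) (h : ∀ f k : ℕ, f ≤ 3 → k + f < K → 2 ^ k + 2 ^ (k + f) ∈ D) :
    4 * K - 6 ≤ D.card := by
  set s : Finset (Σ _ : ℕ, ℕ) := (range 4).sigma fun f => range (K - f) with hs
  set g : (Σ _ : ℕ, ℕ) → ℕ := fun x => 2 ^ x.2 + 2 ^ (x.2 + x.1) with hg
  have hcard : s.card = (K - 0) + (K - 1) + (K - 2) + (K - 3) := by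
    rw [hs, Finset.card_sigma]
    simp only [Finset.sum_range_succ, Finset.sum_range_zero, Finset.card_range, zero_add]
  have hinj : Set.InjOn g (s : Set (Σ _ : ℕ, ℕ)) := by
    rintro ⟨f₁, k₁⟩ - ⟨f₂, k₂⟩ - hxy
    simp only [hg] at hxy
    rcases two_pow_sidon _ _ _ _ hxy with ⟨h1, h2⟩ | ⟨h1, h2⟩
    · obtain rfl : k₁ = k₂ := h1
      obtain rfl : f₁ = f₂ := by omega
      rfl
    · obtain rfl : f₁ = f₂ := by omega
      obtain rfl : k₁ = k₂ := by omega
      rfl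
  have hsub : s.image g ⊆ D := by
    intro x hx
    obtain ⟨⟨f, k⟩, hfk, rfl⟩ := Finset.mem_image.1 hx
    simp only [hs, Finset.mem_sigma, Finset.mem_range] at hfk
    exact h f k (by omega) (by omega)
  have := Finset.card_le_card hsub
  rw [Finset.card_image_of_injOn hinj, hcard] at this
  omega

/-! ## §3 The sharpness theorem for general letters -/

/-- **THE GENERAL WIDTH-TWO SIDON ROW IS ATTAINED, UNFOLDED:** over any field with a non-archimedean absolute value `v` and any `π` with
`0 < v π < 1`, for every `K` there is a `2 × 2` lacunary pencil (arbitrary letters) with `K` letters on a Sidon support having at least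
`4K − 6` dominant exponents (so `npEdges ≥ 4K − 7`, matching `valGenSidonTwo_unitTwo_unfolded` wherever `v 2 = 1`).  Witness: `d_i = 2^i`,
`M_i = [[π^{(32i+64)2^i}, π^{(32i+104)2^i}], [π^{(32i+29)2^i}, π^{(32i+43)2^i}]]`. [explicit two-staircase family] -/
theorem valGenSidonTwo_sharp_unfolded :
    ∀ (F : Type) [Field F] (v : AbsoluteValue F ℝ), IsNonarchimedean v → ∀ π : F, 0 < v π → v π < 1 → ∀ K : ℕ,
      ∃ (d : Fin K → ℕ) (M : Fin K → Matrix (Fin 2) (Fin 2) F),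
        (∀ l₁ l₂ l₃ l₄ : Fin K, d l₁ + d l₂ = d l₃ + d l₄ → (l₁ = l₃ ∧ l₂ = l₄) ∨ (l₁ = l₄ ∧ l₂ = l₃)) ∧
        4 * K - 6 ≤ ((Matrix.det (∑ l, ((Polynomial.X : Polynomial F) ^ d l) • (M l).map Polynomial.C)).support.filter fun E =>
            ∃ r : ℝ, 0 < r ∧ ∀ E' ∈ (Matrix.det (∑ l, ((Polynomial.X : Polynomial F) ^ d l) • (M l).map Polynomial.C)).support,
              E' ≠ E →
              v ((Matrix.det (∑ l, ((Polynomial.X : Polynomial F) ^ d l) • (M l).map Polynomial.C)).coeff E') * r ^ E'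
                < v ((Matrix.det (∑ l, ((Polynomial.X : Polynomial F) ^ d l) • (M l).map Polynomial.C)).coeff E) * r ^ E).card := by
  intro F _ v hv π hπ0 hπ1 K
  -- the family
  set A : Fin K → ℕ := fun l => (32 * (l : ℕ) + 64) * 2 ^ (l : ℕ) with hA
  set B : Fin K → ℕ := fun l => (32 * (l : ℕ) + 104) * 2 ^ (l : ℕ) with hB
  set C : Fin K → ℕ := fun l => (32 * (l : ℕ) + 29) * 2 ^ (l : ℕ) with hC
  set E : Fin K → ℕ := fun l => (32 * (l : ℕ) + 43) * 2 ^ (l : ℕ) with hE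
  set d : Fin K → ℕ := fun l => 2 ^ (l : ℕ) with hd
  set M : Fin K → Matrix (Fin 2) (Fin 2) F := fun l => !![π ^ A l, π ^ B l; π ^ C l, π ^ E l] with hM
  have hM00 : ∀ l, M l 0 0 = π ^ A l := fun l => rfl
  have hM01 : ∀ l, M l 0 1 = π ^ B l := fun l => rfl
  have hM10 : ∀ l, M l 1 0 = π ^ C l := fun l => rfl
  have hM11 : ∀ l, M l 1 1 = π ^ E l := fun l => rfl
  have hsid : ∀ l₁ l₂ l₃ l₄ : Fin K, d l₁ + d l₂ = d l₃ + d l₄ → (l₁ = l₃ ∧ l₂ = l₄) ∨ (l₁ = l₄ ∧ l₂ = l₃) :=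
      fun l₁ l₂ l₃ l₄ h => by
    rcases two_pow_sidon _ _ _ _ h with ⟨h1, h2⟩ | ⟨h1, h2⟩
    · exact Or.inl ⟨Fin.ext h1, Fin.ext h2⟩
    · exact Or.inr ⟨Fin.ext h1, Fin.ext h2⟩
  refine ⟨d, M, hsid, ?_⟩
  set f : F[X] := Matrix.det (∑ l, ((X : F[X]) ^ d l) • (M l).map (Polynomial.C : F →+* F[X])) with hf
  set w : ℝ := v π with hw
  -- coefficients
  have hoff : ∀ p q : Fin K, p ≠ q →
      f.coeff (d p + d q) = π ^ A p * π ^ E q + π ^ A q * π ^ E p - π ^ B p * π ^ C q - π ^ B q * π ^ C p := by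
    intro p q hpq
    rw [hf, coeff_offdiag_gen_of_sidon d M hsid hpq, hM00, hM11, hM00, hM11, hM01, hM10, hM01, hM10]
  have hdiag : ∀ p : Fin K, f.coeff (d p + d p) = π ^ A p * π ^ E p - π ^ B p * π ^ C p := by
    intro p
    rw [hf, coeff_diag_gen_of_sidon d M hsid p, hM00, hM11, hM01, hM10]
  have hsupp : ∀ E' ∈ f.support, ∃ p q : Fin K, E' = d p + d q := by
    intro E' hE'
    have hne := Polynomial.mem_support_iff.1 hE'
    rw [hf, coeff_det_genPencil_two d M E'] at hne
    obtain ⟨pq, hpq, -⟩ := Finset.exists_ne_zero_of_sum_ne_zero hne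
    exact ⟨pq.1, pq.2, ((Finset.mem_filter.1 hpq).2).symm⟩
  -- sizes of terms
  have hvpow : ∀ a b : ℕ, v (π ^ a * π ^ b) = w ^ (a + b) := by
    intro a b
    rw [map_mul, map_pow, map_pow, ← pow_add]
  have hbound : ∀ p q : Fin K, v (f.coeff (d p + d q)) ≤
      max (max (w ^ (A p + E q)) (w ^ (A q + E p))) (max (w ^ (B p + C q)) (w ^ (B q + C p))) := by
    intro p q
    by_cases hpq : p = q
    · subst hpq
      rw [hdiag]
      refine (abv_sub_le_max_na v hv _ _).trans ?_
      rw [hvpow, hvpow, max_self, max_self]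
    · rw [hoff p q hpq]
      refine (abv_sub_le_max_na v hv _ _).trans (max_le ((abv_sub_le_max_na v hv _ _).trans (max_le ((hv _ _).trans ?_) ?_)) ?_)
      · rw [hvpow, hvpow]; exact le_max_left _ _
      · rw [hvpow]; exact (le_max_left _ _).trans (le_max_right _ _)
      · rw [hvpow]; exact (le_max_right _ _).trans (le_max_right _ _)
  -- exact sizes at the four bands
  have hwlt : ∀ {m m' : ℕ}, m < m' → w ^ m' < w ^ m := fun {m m'} h => pow_lt_pow_right_of_lt_one₀ hπ0 hπ1 h
  have hcancel : ∀ {n e t : ℕ}, n + t < e + t → n < e := fun {n e t} h => by omega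
  have hval0 : ∀ k : Fin K, v (f.coeff (d k + d k)) = w ^ (A k + E k) := by
    intro k
    rw [hdiag, sub_eq_add_neg, abv_add_eq_left_of_lt v hv, hvpow]
    rw [v.map_neg, hvpow, hvpow]
    refine hwlt (hcancel (t := (32 * (k : ℕ) + 98) * (2 ^ (k : ℕ) + 2 ^ (k : ℕ))) ?_)
    have h := gen0_vs_bc (k : ℕ) k k
    simp only [hA, hB, hC, hE] at h ⊢; linarith [h]
  have hval1 : ∀ k k' : Fin K, (k' : ℕ) = k + 1 → v (f.coeff (d k + d k')) = w ^ (A k + E k') := by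
    intro k k' hk'
    have hne : k ≠ k' := fun h => by rw [h] at hk'; omega
    rw [hoff k k' hne, abv_four_eq_first v hv, hvpow]
    · rw [hvpow, hvpow]
      refine hwlt (hcancel (t := (32 * (k : ℕ) + 120) * (2 ^ (k : ℕ) + 2 ^ (k' : ℕ))) ?_)
      have h := gen1_vs_ae (k : ℕ) k' k (by omega)
      simp only [hA, hE, hk'] at h ⊢; linarith [h, Nat.add_comm (2 ^ (k : ℕ)) (2 ^ ((k : ℕ) + 1))]
    · rw [hvpow, hvpow]
      refine hwlt (hcancel (t := (32 * (k : ℕ) + 120) * (2 ^ (k : ℕ) + 2 ^ (k' : ℕ))) ?_)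
      have h := gen1_vs_bc (k : ℕ) k k'
      simp only [hA, hB, hC, hE, hk'] at h ⊢; linarith [h]
    · rw [hvpow, hvpow]
      refine hwlt (hcancel (t := (32 * (k : ℕ) + 120) * (2 ^ (k : ℕ) + 2 ^ (k' : ℕ))) ?_)
      have h := gen1_vs_bc (k : ℕ) k' k
      simp only [hA, hB, hC, hE, hk'] at h ⊢; linarith [h, Nat.add_comm (2 ^ (k : ℕ)) (2 ^ ((k : ℕ) + 1))]
  have hval2 : ∀ k k' : Fin K, (k' : ℕ) = k + 2 → v (f.coeff (d k + d k')) = w ^ (B k + C k') := by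
    intro k k' hk'
    have hne : k ≠ k' := fun h => by rw [h] at hk'; omega
    rw [hoff k k' hne, abv_four_eq_third v hv, hvpow]
    · rw [hvpow, hvpow]
      refine hwlt (hcancel (t := (32 * (k : ℕ) + 140) * (2 ^ (k : ℕ) + 2 ^ (k' : ℕ))) ?_)
      have h := gen2_vs_ae (k : ℕ) k k'
      simp only [hA, hB, hC, hE, hk'] at h ⊢; linarith [h]
    · rw [hvpow, hvpow]
      refine hwlt (hcancel (t := (32 * (k : ℕ) + 140) * (2 ^ (k : ℕ) + 2 ^ (k' : ℕ))) ?_)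
      have h := gen2_vs_ae (k : ℕ) k' k
      simp only [hA, hB, hC, hE, hk'] at h ⊢; linarith [h, Nat.add_comm (2 ^ (k : ℕ)) (2 ^ ((k : ℕ) + 2))]
    · rw [hvpow, hvpow]
      refine hwlt (hcancel (t := (32 * (k : ℕ) + 140) * (2 ^ (k : ℕ) + 2 ^ (k' : ℕ))) ?_)
      have h := gen2_vs_bc (k : ℕ) k' k (by omega)
      simp only [hB, hC, hk'] at h ⊢; linarith [h, Nat.add_comm (2 ^ (k : ℕ)) (2 ^ ((k : ℕ) + 2))]
  have hval3 : ∀ k k' : Fin K, (k' : ℕ) = k + 3 → v (f.coeff (d k + d k')) = w ^ (B k + C k') := by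
    intro k k' hk'
    have hne : k ≠ k' := fun h => by rw [h] at hk'; omega
    rw [hoff k k' hne, abv_four_eq_third v hv, hvpow]
    · rw [hvpow, hvpow]
      refine hwlt (hcancel (t := (32 * (k : ℕ) + 166) * (2 ^ (k : ℕ) + 2 ^ (k' : ℕ))) ?_)
      have h := gen3_vs_ae (k : ℕ) k k'
      simp only [hA, hB, hC, hE, hk'] at h ⊢; linarith [h]
    · rw [hvpow, hvpow]
      refine hwlt (hcancel (t := (32 * (k : ℕ) + 166) * (2 ^ (k : ℕ) + 2 ^ (k' : ℕ))) ?_)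
      have h := gen3_vs_ae (k : ℕ) k' k
      simp only [hA, hB, hC, hE, hk'] at h ⊢; linarith [h, Nat.add_comm (2 ^ (k : ℕ)) (2 ^ ((k : ℕ) + 3))]
    · rw [hvpow, hvpow]
      refine hwlt (hcancel (t := (32 * (k : ℕ) + 166) * (2 ^ (k : ℕ) + 2 ^ (k' : ℕ))) ?_)
      have h := gen3_vs_bc (k : ℕ) k' k (by omega)
      simp only [hB, hC, hk'] at h ⊢; linarith [h, Nat.add_comm (2 ^ (k : ℕ)) (2 ^ ((k : ℕ) + 3))]
  -- the set of dominant exponents and the four bands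
  set D := f.support.filter fun Ex => ∃ r : ℝ, 0 < r ∧ ∀ E' ∈ f.support, E' ≠ Ex →
      v (f.coeff E') * r ^ E' < v (f.coeff Ex) * r ^ Ex with hD
  have hpair_ne : ∀ (p q : Fin K) (a b : ℕ), d p + d q ≠ 2 ^ a + 2 ^ b → ¬ ((p : ℕ) = a ∧ (q : ℕ) = b) := by
    rintro p q a b h ⟨rfl, rfl⟩
    exact h rfl
  have hpair_ne' : ∀ (p q : Fin K) (a b : ℕ), d p + d q ≠ 2 ^ a + 2 ^ b → ¬ ((q : ℕ) = a ∧ (p : ℕ) = b) := by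
    rintro p q a b h ⟨rfl, rfl⟩
    exact h (Nat.add_comm _ _)
  have hdom0 : ∀ k : Fin K, d k + d k ∈ D := by
    intro k
    refine Finset.mem_filter.2 (dominant_of_termwise4 v hπ0 hπ1 f d A B C E (d k + d k) (A k + E k) (32 * k + 98) hsupp hbound
      (hval0 k) fun p q hne => ⟨?_, ?_, ?_, ?_⟩)
    · have h := gen0_vs_ae (k : ℕ) p q (hpair_ne p q k k hne)
      simp only [hA, hE, hd] at h ⊢; linarith [h]
    · have h := gen0_vs_ae (k : ℕ) q p (hpair_ne' p q k k hne)
      simp only [hA, hE, hd] at h ⊢; linarith [h, Nat.add_comm (2 ^ (p : ℕ)) (2 ^ (q : ℕ))]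
    · have h := gen0_vs_bc (k : ℕ) p q
      simp only [hA, hB, hC, hE, hd] at h ⊢; linarith [h]
    · have h := gen0_vs_bc (k : ℕ) q p
      simp only [hA, hB, hC, hE, hd] at h ⊢; linarith [h, Nat.add_comm (2 ^ (p : ℕ)) (2 ^ (q : ℕ))]
  have hdom1 : ∀ k k' : Fin K, (k' : ℕ) = k + 1 → d k + d k' ∈ D := by
    intro k k' hk'
    refine Finset.mem_filter.2 (dominant_of_termwise4 v hπ0 hπ1 f d A B C E (d k + d k') (A k + E k') (32 * k + 120) hsupp hbound
      (hval1 k k' hk') fun p q hne => ⟨?_, ?_, ?_, ?_⟩)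
    · have h := gen1_vs_ae (k : ℕ) p q (by simp only [hd, hk'] at hne; exact hpair_ne p q k (k + 1) hne)
      simp only [hA, hE, hd, hk'] at h ⊢; linarith [h]
    · have h := gen1_vs_ae (k : ℕ) q p (by simp only [hd, hk'] at hne; exact hpair_ne' p q k (k + 1) hne)
      simp only [hA, hE, hd, hk'] at h ⊢; linarith [h, Nat.add_comm (2 ^ (p : ℕ)) (2 ^ (q : ℕ))]
    · have h := gen1_vs_bc (k : ℕ) p q
      simp only [hA, hB, hC, hE, hd, hk'] at h ⊢; linarith [h]
    · have h := gen1_vs_bc (k : ℕ) q p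
      simp only [hA, hB, hC, hE, hd, hk'] at h ⊢; linarith [h, Nat.add_comm (2 ^ (p : ℕ)) (2 ^ (q : ℕ))]
  have hdom2 : ∀ k k' : Fin K, (k' : ℕ) = k + 2 → d k + d k' ∈ D := by
    intro k k' hk'
    refine Finset.mem_filter.2 (dominant_of_termwise4 v hπ0 hπ1 f d A B C E (d k + d k') (B k + C k') (32 * k + 140) hsupp hbound
      (hval2 k k' hk') fun p q hne => ⟨?_, ?_, ?_, ?_⟩)
    · have h := gen2_vs_ae (k : ℕ) p q
      simp only [hA, hB, hC, hE, hd, hk'] at h ⊢; linarith [h]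
    · have h := gen2_vs_ae (k : ℕ) q p
      simp only [hA, hB, hC, hE, hd, hk'] at h ⊢; linarith [h, Nat.add_comm (2 ^ (p : ℕ)) (2 ^ (q : ℕ))]
    · have h := gen2_vs_bc (k : ℕ) p q (by simp only [hd, hk'] at hne; exact hpair_ne p q k (k + 2) hne)
      simp only [hB, hC, hd, hk'] at h ⊢; linarith [h]
    · have h := gen2_vs_bc (k : ℕ) q p (by simp only [hd, hk'] at hne; exact hpair_ne' p q k (k + 2) hne)
      simp only [hB, hC, hd, hk'] at h ⊢; linarith [h, Nat.add_comm (2 ^ (p : ℕ)) (2 ^ (q : ℕ))]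
  have hdom3 : ∀ k k' : Fin K, (k' : ℕ) = k + 3 → d k + d k' ∈ D := by
    intro k k' hk'
    refine Finset.mem_filter.2 (dominant_of_termwise4 v hπ0 hπ1 f d A B C E (d k + d k') (B k + C k') (32 * k + 166) hsupp hbound
      (hval3 k k' hk') fun p q hne => ⟨?_, ?_, ?_, ?_⟩)
    · have h := gen3_vs_ae (k : ℕ) p q
      simp only [hA, hB, hC, hE, hd, hk'] at h ⊢; linarith [h]
    · have h := gen3_vs_ae (k : ℕ) q p
      simp only [hA, hB, hC, hE, hd, hk'] at h ⊢; linarith [h, Nat.add_comm (2 ^ (p : ℕ)) (2 ^ (q : ℕ))]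
    · have h := gen3_vs_bc (k : ℕ) p q (by simp only [hd, hk'] at hne; exact hpair_ne p q k (k + 3) hne)
      simp only [hB, hC, hd, hk'] at h ⊢; linarith [h]
    · have h := gen3_vs_bc (k : ℕ) q p (by simp only [hd, hk'] at hne; exact hpair_ne' p q k (k + 3) hne)
      simp only [hB, hC, hd, hk'] at h ⊢; linarith [h, Nat.add_comm (2 ^ (p : ℕ)) (2 ^ (q : ℕ))]
  -- counting
  refine card_ge_of_four_bands K D fun fo k hfo hk => ?_
  have hk0 : k < K := by omega
  interval_cases fo
  · exact hdom0 ⟨k, hk0⟩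
  · exact hdom1 ⟨k, hk0⟩ ⟨k + 1, hk⟩ rfl
  · exact hdom2 ⟨k, hk0⟩ ⟨k + 2, hk⟩ rfl
  · exact hdom3 ⟨k, hk0⟩ ⟨k + 3, hk⟩ rfl

/-- **SHARPNESS OVER `ℝ` (characteristic zero, as in the custody row `GenValRootLawAt`):** with the tree's 2-adic place of `ℝ`
(`…TwoAdicOnReals.twoAdicOnReals_unfolded`, `π = 2`), for every `K` some real `2 × 2` Sidon pencil has at least `4K − 6` dominant
exponents — so no bound below `4K − 7` holds for the Sidon-restricted general `(2, K)` valuative row. [corollary] -/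
theorem valGenSidonTwo_sharp_real (K : ℕ) :
    ∃ (w : AbsoluteValue ℝ ℝ) (d : Fin K → ℕ) (M : Fin K → Matrix (Fin 2) (Fin 2) ℝ), IsNonarchimedean w ∧
      (∀ l₁ l₂ l₃ l₄ : Fin K, d l₁ + d l₂ = d l₃ + d l₄ → (l₁ = l₃ ∧ l₂ = l₄) ∨ (l₁ = l₄ ∧ l₂ = l₃)) ∧
      4 * K - 6 ≤ ((Matrix.det (∑ l, ((Polynomial.X : Polynomial ℝ) ^ d l) • (M l).map Polynomial.C)).support.filter fun E =>
          ∃ r : ℝ, 0 < r ∧ ∀ E' ∈ (Matrix.det (∑ l, ((Polynomial.X : Polynomial ℝ) ^ d l) • (M l).map Polynomial.C)).support,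
            E' ≠ E →
            w ((Matrix.det (∑ l, ((Polynomial.X : Polynomial ℝ) ^ d l) • (M l).map Polynomial.C)).coeff E') * r ^ E'
              < w ((Matrix.det (∑ l, ((Polynomial.X : Polynomial ℝ) ^ d l) • (M l).map Polynomial.C)).coeff E) * r ^ E).card := by
  obtain ⟨w, hw, hw2⟩ := twoAdicOnReals_unfolded
  obtain ⟨d, M, hsid, hcard⟩ := valGenSidonTwo_sharp_unfolded ℝ w hw 2 (w.pos two_ne_zero) hw2 K
  exact ⟨w, d, M, hw, hsid, hcard⟩

end Summit.ValiantsHypothesis.ValiantsHypothesis.Theorems.KPlusLogSqLaw.ValDoor
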